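import Literature.LinearAlgebra.Matrix.WeightedGeometricMean
import Literature.LinearAlgebra.Matrix.FurutaInequality
import Literature.LinearAlgebra.Matrix.PolarDecompositionGeneral
import HarnessLib

/-!
# The Ando–Hiai inequality `A #_α B ≤ I ⟹ Aʳ #_α Bʳ ≤ I` (`r ≥ 1`), with the Kubo–Ando bookkeeping of the weighted
# geometric mean it needs: the transformer equality `(X^*AX) #_α (X^*BX) = X^*(A #_α B)X`, joint monotonicity,
# `Cᵃ #_α Cᵇ = C^{(1−α)a+αb}`, homogeneity (Ando–Hiai 1994, Theorem 2.1 / (2.5))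

Hodge foundations lane (`lit-hodgefound`, prover p24 gen 63; matrix-analysis series, sequel of `WeightedGeometricMean.lean`
(`A #_t B` spelled out, `A #_t B = B #_{1−t} A`, Young), `LoewnerHeinzInequality.lean` (Löwner–Heinz `A ≤ B ⟹ Aʳ ≤ Bʳ`,
`0 ≤ r ≤ 1`, and the `A ^ r` dictionary), `FurutaInequality.lean`, `PolarDecompositionGeneral.lean`
(`exists_unitary_polar`) and `JensenOperatorInequality.lean` (`Uᴴ f(X) U = f(Uᴴ X U)`)).  THEOREMS ONLY: no definition,
no named fact, net debt 0.  Complex matrices (the Löwner–Heinz step is the tree's `ℂ`-statement).  As in the tree, the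
weighted geometric mean is SPELLED OUT: `A #_t B` is `CFC.sqrt A * ((CFC.sqrt A)⁻¹ * B * (CFC.sqrt A)⁻¹) ^ t * CFC.sqrt A`
(`A^{1/2}(A^{-1/2}BA^{-1/2})^tA^{1/2}`, `^ t` = Mathlib's `CFC.rpow`), `Y ≤ Z` is `(Z - Y).PosSemidef`, `Aʳ = A ^ r`.

## Source, VERBATIM — T. Ando, F. Hiai, *Log majorization and complementary Golden–Thompson type inequalities*,
Linear Algebra Appl. 197/198 (1994) 113–131 [AndoHiai1994] (held text `paper:doi-10-1016-0024-3795-94-90484-7`,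
§ 2 pp. 118–120)

«For `0 ≤ α ≤ 1`, the α-power mean `A #_α B` for `A, B > 0` is defined by `A #_α B = A^{1/2}(A^{-1/2}BA^{-1/2})^αA^{1/2}`
… Note that `A #_α B = B #_{1−α} A` and if `AB = BA` then `A #_α B = A^{1−α}B^α`, and that `(A, B) ↦ A #_α B` is jointly
monotone. **Theorem 2.1.** For every `A, B ≥ 0` and `0 ≤ α ≤ 1`, `(Aʳ #_α Bʳ) ≺_(log) (A #_α B)ʳ`, `r ≥ 1` (2.2) …
*Proof.* … it suffices by Lemma 1.3 to show that `λ₁(Aʳ #_α Bʳ) ≤ λ₁(A #_α B)ʳ` (2.5). To do so we may prove that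
`A #_α B ≤ I` implies `Aʳ #_α Bʳ ≤ I`, because both sides of (2.5) have the same order of homogeneity for `A, B`, so
that we can multiply `A, B` by a positive constant. First let us assume `1 ≤ r ≤ 2` and write `r = 2 − ε` with
`0 ≤ ε ≤ 1`. Let `C = A^{-1/2}BA^{-1/2}`. Then `B = A^{1/2}CA^{1/2}` and `A #_α B = A^{1/2}C^αA^{1/2}`. If `A #_α B ≤ I`
then `C^α ≤ A⁻¹`, so that `A ≤ C^{-α}` (2.6). Hence by Lemma 1.4 [Löwner–Heinz] `A^{1−ε} ≤ C^{−α(1−ε)}` (2.7). We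
now get `Aʳ #_α Bʳ = … = A^{1/2}{A^{1−ε} #_α [C(A #_ε C⁻¹)C]}A^{1/2} ≤ A^{1/2}{C^{−α(1−ε)} #_α [C(C^{−α} #_ε C⁻¹)C]}
A^{1/2}`, using (2.6), (2.7), and the joint monotonicity of power means. Since a direct computation yields
`C^{−α(1−ε)} #_α [C(C^{−α} #_ε C⁻¹)C] = C^α`, we get `Aʳ #_α Bʳ ≤ A^{1/2}C^αA^{1/2} = A #_α B ≤ I`. When `r > 2`,
writing `r = 2^k s` with `1 ≤ s ≤ 2`, proceed by induction.»

## What is formalized (all PROVED; `A, B ≻ 0`, `t ∈ [0, 1]` where an inequality is claimed)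

* § 0 plumbing: `(Cᵃ)ˢ = C^{as}` for `C ≻ 0` and ALL real `a, s` (`rpow_rpow'`), `(Cᵃ)^{1/2} = C^{a/2}` (`sqrt_rpow`),
  `C·Cᵉ·C = C^{e+2}` (`mul_rpow_mul_self`).
* § 1 **the transformer equality** `(X^*PX) #_t (X^*QX) = X^*(P #_t Q)X` for nonsingular `X`, `P ≻ 0`, `Q ⪰ 0` and
  every real `t` (`conj_wgm`; road: polar decomposition `P^{1/2}X = U·(X^*PX)^{1/2}` (the tree's `exists_unitary_polar`),
  so `(X^*PX)^{-1/2}(X^*QX)(X^*PX)^{-1/2} = Uᴴ(P^{-1/2}QP^{-1/2})U`, and `(UᴴDU)^t = UᴴD^tU`), and its Hermitian form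
  `(SPS) #_t (SQS) = S(P #_t Q)S` (`sqrt_conj_wgm`).
* § 2 **joint monotonicity** «`(A, B) ↦ A #_α B` is jointly monotone»: `wgm_mono_right` (Löwner–Heinz on
  `A^{-1/2}BA^{-1/2}`), `wgm_mono_left` (through `A #_t B = B #_{1−t} A`), `wgm_mono`.
* § 3 «if `AB = BA` then `A #_α B = A^{1−α}B^α`» for powers of one matrix: `Cᵃ #_t Cᵇ = C^{(1−t)a+tb}` (`rpow_wgm_rpow`).
* § 4 «If `A #_α B ≤ I` then `C^α ≤ A⁻¹`, so that `A ≤ C^{−α}`» (`rpow_le_inv_of_wgm_le_one`, `le_rpow_neg_of_wgm_le_one`).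
* § 5 **the step `1 ≤ r ≤ 2`** (`andoHiai_step`, the displayed computation verbatim: (2.6), (2.7), the identity
  `Aʳ #_α Bʳ = A^{1/2}{A^{1−ε} #_α [C(A #_ε C⁻¹)C]}A^{1/2}` by § 1, joint monotonicity by § 2, the «direct computation»
  by § 3).
* § 6 **the Ando–Hiai inequality** `A #_t B ≤ I ⟹ Aʳ #_t Bʳ ≤ I` for every `r ≥ 1` (`andoHiai`, induction over
  `r ≤ 2^k` by the step applied to `(A^{r/2}, B^{r/2})`).
* § 7 homogeneity `(cA) #_t (cB) = c(A #_t B)` (`wgm_smul`), the homogeneous form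
  **`A #_t B ≤ cI ⟹ Aʳ #_t Bʳ ≤ cʳI`** (`andoHiai_smul`, i.e. (2.5) `λ₁(Aʳ #_α Bʳ) ≤ λ₁(A #_α B)ʳ` in Loewner form), and
  the case `t = 1/2`: `A#B ≤ I ⟹ Aʳ#Bʳ ≤ I` with the tree's `CFC.sqrt` spelling of `A#B` (`andoHiai_geometricMean`).

NOT covered: the log-majorization (2.2)–(2.4) itself (antisymmetric tensor powers, Lemma 1.2 `C_k(A #_α B) =
C_k(A) #_α C_k(B)`), the singular case `A, B ≥ 0`, Theorems 3.x (complementary Golden–Thompson).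
-/

open Matrix
open scoped ComplexOrder MatrixOrder

namespace Literature.LinearAlgebra.Matrix.AndoHiaiInequality

open Literature.LinearAlgebra.Matrix.PosDefGeometricMean
open Literature.LinearAlgebra.Matrix.LoewnerHeinzInequality
open Literature.LinearAlgebra.Matrix.HadamardProductBlockInequalities
open Literature.LinearAlgebra.Matrix.WeightedGeometricMean
open Literature.LinearAlgebra.Matrix.FurutaInequality

variable {n : Type*} [Fintype n] [DecidableEq n]

/-! ## § 0. Plumbing -/

section Plumbing

variable {C X Y Z : Matrix n n ℂ}

omit [Fintype n] [DecidableEq n] in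
/-- Loewner transitivity. [folklore] -/
private theorem loewner_trans (h₁ : (Y - X).PosSemidef) (h₂ : (Z - Y).PosSemidef) : (Z - X).PosSemidef := by
  have h := h₁.add h₂
  rwa [sub_add_sub_cancel'] at h

/-- `(Cᵃ)ˢ = C^{as}` for `C ≻ 0` and all real `a, s` (the tree's `rpow_rpow_of_posDef` asks `a ≠ 0`; for `a = 0` both
sides are `I`). [cite: Bernstein2009, § 8.5 p. 459 (definition of `A^r`)] -/
theorem rpow_rpow' (hC : C.PosDef) (a s : ℝ) : (C ^ a) ^ s = C ^ (a * s) := by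
  rcases eq_or_ne a 0 with rfl | ha
  · rw [rpow_zero hC.posSemidef, zero_mul, rpow_zero hC.posSemidef, CFC.one_rpow]
  · exact rpow_rpow_of_posDef hC ha s

/-- `(Cᵃ)^{1/2} = C^{a/2}` for `C ≻ 0`. [cite: Bernstein2009, § 8.5 p. 459 (definition of `A^r`)] -/
theorem sqrt_rpow (hC : C.PosDef) (a : ℝ) : CFC.sqrt (C ^ a) = C ^ (a / 2) := by
  rw [sqrt_eq_rpow, rpow_rpow' hC, show a * (1 / 2 : ℝ) = a / 2 by ring]

/-- `C·Cᵉ·C = C^{e+2}` for `C ≻ 0`. [cite: Bernstein2009, § 8.5 p. 459 (definition of `A^r`)] -/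
theorem mul_rpow_mul_self (hC : C.PosDef) (e : ℝ) : C * C ^ e * C = C ^ (e + 2) := by
  have h1 : C ^ (1 : ℝ) = C := rpow_one hC.posSemidef
  calc C * C ^ e * C = C ^ (1 : ℝ) * C ^ e * C ^ (1 : ℝ) := by rw [h1]
    _ = C ^ (e + 2) := by rw [← rpow_add_of_posDef hC, ← rpow_add_of_posDef hC]; congr 1; ring

end Plumbing

/-! ## § 1. The transformer equality `(X^*PX) #_t (X^*QX) = X^*(P #_t Q)X` -/

section Transformer

variable {P Q X S : Matrix n n ℂ}

/-- **Transformer equality for the weighted geometric mean**: for nonsingular `X`, `P ≻ 0`, `Q ⪰ 0` and every real `t`,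
`(X^*PX) #_t (X^*QX) = X^*(P #_t Q)X`.  Road: with the polar decomposition `P^{1/2}X = U(X^*PX)^{1/2}` (`U` unitary),
`(X^*PX)^{-1/2}(X^*QX)(X^*PX)^{-1/2} = U^*(P^{-1/2}QP^{-1/2})U`, powers commute with unitary conjugation, and
`(X^*PX)^{1/2}U^* = X^*P^{1/2}`. [cite: AndoHiai1994, § 2 p. 118 («operator mean corresponding to the operator monotone
function `t^α`»; transformer equality of operator means, Kubo–Ando [9])] -/
theorem conj_wgm (hP : P.PosDef) (hQ : Q.PosSemidef) (hX : IsUnit X.det) (t : ℝ) :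
    CFC.sqrt (Xᴴ * P * X) * ((CFC.sqrt (Xᴴ * P * X))⁻¹ * (Xᴴ * Q * X) * (CFC.sqrt (Xᴴ * P * X))⁻¹) ^ t *
        CFC.sqrt (Xᴴ * P * X) =
      Xᴴ * (CFC.sqrt P * ((CFC.sqrt P)⁻¹ * Q * (CFC.sqrt P)⁻¹) ^ t * CFC.sqrt P) * X := by
  have hSu : IsUnit (CFC.sqrt P).det := isUnit_det_sqrt hP
  have hSh : (CFC.sqrt P)ᴴ = CFC.sqrt P := conjTranspose_sqrt P
  have hSS : CFC.sqrt P * CFC.sqrt P = P := CFC.sqrt_mul_sqrt_self P hP.posSemidef.nonneg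
  set S := CFC.sqrt P with hSdef
  have hXu : IsUnit X := (isUnit_iff_isUnit_det X).mpr hX
  have hPX : (Xᴴ * P * X).PosDef := by
    have h := (Matrix.IsUnit.posDef_star_left_conjugate_iff hXu).mpr hP
    rwa [star_eq_conjTranspose] at h
  have hRu : IsUnit (CFC.sqrt (Xᴴ * P * X)).det := isUnit_det_sqrt hPX
  have hRh : (CFC.sqrt (Xᴴ * P * X))ᴴ = CFC.sqrt (Xᴴ * P * X) := conjTranspose_sqrt _
  set R := CFC.sqrt (Xᴴ * P * X) with hRdef
  -- polar decomposition of `K = P^{1/2} X`: `K = U (K^*K)^{1/2} = U R`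
  have hKK : (S * X)ᴴ * (S * X) = Xᴴ * P * X := by
    rw [conjTranspose_mul, hSh, ← hSS]
    simp only [Matrix.mul_assoc]
  obtain ⟨U, hU, -, hpolar⟩ := Literature.LinearAlgebra.Matrix.exists_unitary_polar (S * X)
  rw [hKK, ← hRdef] at hpolar
  have hU1 : Uᴴ * U = 1 := by
    have h := Matrix.mem_unitaryGroup_iff'.mp hU
    rwa [star_eq_conjTranspose] at h
  -- `X = P^{-1/2} U R`, `X^* = R U^* P^{-1/2}`
  have hXeq : X = S⁻¹ * (U * R) := by rw [← hpolar, ← Matrix.mul_assoc, nonsing_inv_mul _ hSu, Matrix.one_mul]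
  have hXh : Xᴴ = R * Uᴴ * S⁻¹ := by
    rw [hXeq, conjTranspose_mul, conjTranspose_mul, conjTranspose_nonsing_inv, hSh, hRh]
  -- the inner matrix is a unitary conjugate of `D = P^{-1/2} Q P^{-1/2}`
  have hD : (S⁻¹ * Q * S⁻¹).PosSemidef := by
    have h := hQ.conjTranspose_mul_mul_same S⁻¹
    rwa [conjTranspose_nonsing_inv, hSh] at h
  have hD' : (Uᴴ * (S⁻¹ * Q * S⁻¹) * U).PosSemidef := hD.conjTranspose_mul_mul_same U
  have hinner : R⁻¹ * (Xᴴ * Q * X) * R⁻¹ = Uᴴ * (S⁻¹ * Q * S⁻¹) * U := by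
    rw [hXh, hXeq]
    calc R⁻¹ * (R * Uᴴ * S⁻¹ * Q * (S⁻¹ * (U * R))) * R⁻¹
        = R⁻¹ * R * (Uᴴ * (S⁻¹ * Q * S⁻¹) * U) * (R * R⁻¹) := by simp only [Matrix.mul_assoc]
      _ = Uᴴ * (S⁻¹ * Q * S⁻¹) * U := by
        rw [nonsing_inv_mul _ hRu, mul_nonsing_inv _ hRu, Matrix.one_mul, Matrix.mul_one]
  have hpow : (R⁻¹ * (Xᴴ * Q * X) * R⁻¹) ^ t = Uᴴ * (S⁻¹ * Q * S⁻¹) ^ t * U := by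
    rw [hinner, rpow_eq_cfc hD', rpow_eq_cfc hD,
      Literature.LinearAlgebra.Matrix.conjTranspose_mul_cfc_mul_of_unitary U hU1 hD.1]
  rw [hpow, hXh, hXeq]
  symm
  calc R * Uᴴ * S⁻¹ * (S * (S⁻¹ * Q * S⁻¹) ^ t * S) * (S⁻¹ * (U * R))
      = R * Uᴴ * (S⁻¹ * S) * (S⁻¹ * Q * S⁻¹) ^ t * (S * S⁻¹) * (U * R) := by simp only [Matrix.mul_assoc]
    _ = R * (Uᴴ * (S⁻¹ * Q * S⁻¹) ^ t * U) * R := by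
      rw [nonsing_inv_mul _ hSu, mul_nonsing_inv _ hSu, Matrix.mul_one, Matrix.mul_one]
      simp only [Matrix.mul_assoc]

/-- The transformer equality for a positive definite congruence `S = S^*`: `(SPS) #_t (SQS) = S(P #_t Q)S`.
[cite: AndoHiai1994, § 2 p. 118, proof of Thm 2.1 p. 120 (`Aʳ #_α Bʳ = A^{1/2}{A^{1−ε} #_α […]}A^{1/2}`)] -/
theorem sqrt_conj_wgm (hP : P.PosDef) (hQ : Q.PosSemidef) (hS : S.PosDef) (t : ℝ) :
    CFC.sqrt (S * P * S) * ((CFC.sqrt (S * P * S))⁻¹ * (S * Q * S) * (CFC.sqrt (S * P * S))⁻¹) ^ t *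
        CFC.sqrt (S * P * S) =
      S * (CFC.sqrt P * ((CFC.sqrt P)⁻¹ * Q * (CFC.sqrt P)⁻¹) ^ t * CFC.sqrt P) * S := by
  have h := conj_wgm hP hQ (isUnit_iff_ne_zero.mpr hS.det_pos.ne') t
  rwa [hS.1.eq] at h

end Transformer

/-! ## § 2. Joint monotonicity of `(A, B) ↦ A #_t B` (`t ∈ [0, 1]`) -/

section Monotone

variable {A A₁ A₂ B B₁ B₂ : Matrix n n ℂ}

/-- **Monotone in the second argument**: `B₁ ≤ B₂ ⟹ A #_t B₁ ≤ A #_t B₂` (`t ∈ [0, 1]`; Löwner–Heinz for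
`A^{-1/2}B₁A^{-1/2} ≤ A^{-1/2}B₂A^{-1/2}`, then congruence by `A^{1/2}`). [cite: AndoHiai1994, § 2 p. 118 («jointly
monotone»); Lemma 1.4] -/
theorem wgm_mono_right (h : (B₂ - B₁).PosSemidef) {t : ℝ} (ht0 : 0 ≤ t) (ht1 : t ≤ 1) :
    (CFC.sqrt A * ((CFC.sqrt A)⁻¹ * B₂ * (CFC.sqrt A)⁻¹) ^ t * CFC.sqrt A -
      CFC.sqrt A * ((CFC.sqrt A)⁻¹ * B₁ * (CFC.sqrt A)⁻¹) ^ t * CFC.sqrt A).PosSemidef := by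
  have hSih : ((CFC.sqrt A)⁻¹)ᴴ = (CFC.sqrt A)⁻¹ := by rw [conjTranspose_nonsing_inv, conjTranspose_sqrt]
  have hC : ((CFC.sqrt A)⁻¹ * B₂ * (CFC.sqrt A)⁻¹ - (CFC.sqrt A)⁻¹ * B₁ * (CFC.sqrt A)⁻¹).PosSemidef := by
    have h1 := h.conjTranspose_mul_mul_same (CFC.sqrt A)⁻¹
    rwa [hSih, Matrix.mul_sub, Matrix.sub_mul] at h1
  have h2 := (posSemidef_rpow_sub_rpow hC ht0 ht1).conjTranspose_mul_mul_same (CFC.sqrt A)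
  rwa [conjTranspose_sqrt, Matrix.mul_sub, Matrix.sub_mul] at h2

/-- **Monotone in the first argument**: `A₁ ≤ A₂ ⟹ A₁ #_t B ≤ A₂ #_t B` (`t ∈ [0, 1]`, `A₁, A₂, B ≻ 0`; through
`A #_t B = B #_{1−t} A`). [cite: AndoHiai1994, § 2 p. 118 («`A #_α B = B #_{1−α} A` … jointly monotone»)] -/
theorem wgm_mono_left (hA₁ : A₁.PosDef) (hA₂ : A₂.PosDef) (hB : B.PosDef) (h : (A₂ - A₁).PosSemidef) {t : ℝ}
    (ht0 : 0 ≤ t) (ht1 : t ≤ 1) :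
    (CFC.sqrt A₂ * ((CFC.sqrt A₂)⁻¹ * B * (CFC.sqrt A₂)⁻¹) ^ t * CFC.sqrt A₂ -
      CFC.sqrt A₁ * ((CFC.sqrt A₁)⁻¹ * B * (CFC.sqrt A₁)⁻¹) ^ t * CFC.sqrt A₁).PosSemidef := by
  rw [wgm_symm hA₂ hB t, wgm_symm hA₁ hB t]
  exact wgm_mono_right h (by linarith) (by linarith)

/-- **Joint monotonicity**: `A₁ ≤ A₂`, `B₁ ≤ B₂ ⟹ A₁ #_t B₁ ≤ A₂ #_t B₂` (`t ∈ [0, 1]`, `A₁, A₂, B₂ ≻ 0`).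
[cite: AndoHiai1994, § 2 p. 118 («`(A, B) ↦ A #_α B` is jointly monotone»)] -/
theorem wgm_mono (hA₁ : A₁.PosDef) (hA₂ : A₂.PosDef) (hB₂ : B₂.PosDef) (hA : (A₂ - A₁).PosSemidef)
    (hB : (B₂ - B₁).PosSemidef) {t : ℝ} (ht0 : 0 ≤ t) (ht1 : t ≤ 1) :
    (CFC.sqrt A₂ * ((CFC.sqrt A₂)⁻¹ * B₂ * (CFC.sqrt A₂)⁻¹) ^ t * CFC.sqrt A₂ -
      CFC.sqrt A₁ * ((CFC.sqrt A₁)⁻¹ * B₁ * (CFC.sqrt A₁)⁻¹) ^ t * CFC.sqrt A₁).PosSemidef :=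
  loewner_trans (wgm_mono_right hB ht0 ht1) (wgm_mono_left hA₁ hA₂ hB₂ hA ht0 ht1)

end Monotone

/-! ## § 3. Means of powers of one matrix: `Cᵃ #_t Cᵇ = C^{(1−t)a + tb}` -/

section Commuting

variable {C : Matrix n n ℂ}

/-- **`Cᵃ #_t Cᵇ = C^{(1−t)a + tb}`** for `C ≻ 0` and all real `a, b, t` («if `AB = BA` then `A #_α B = A^{1−α}B^α`»,
for powers of one matrix). [cite: AndoHiai1994, § 2 p. 118; proof of Thm 2.1 p. 120 («a direct computation yields
… `= C^α`»)] -/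
theorem rpow_wgm_rpow (hC : C.PosDef) (a b t : ℝ) :
    CFC.sqrt (C ^ a) * ((CFC.sqrt (C ^ a))⁻¹ * C ^ b * (CFC.sqrt (C ^ a))⁻¹) ^ t * CFC.sqrt (C ^ a) =
      C ^ ((1 - t) * a + t * b) := by
  rw [sqrt_rpow hC, inv_rpow hC, ← rpow_add_of_posDef hC, ← rpow_add_of_posDef hC, rpow_rpow' hC,
    ← rpow_add_of_posDef hC, ← rpow_add_of_posDef hC]
  congr 1
  ring

/-- `C #_t Cᵇ = C^{1 − t + tb}` (`a = 1`). [cite: AndoHiai1994, § 2 p. 118] -/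
theorem wgm_rpow_self (hC : C.PosDef) (b t : ℝ) :
    CFC.sqrt C * ((CFC.sqrt C)⁻¹ * C ^ b * (CFC.sqrt C)⁻¹) ^ t * CFC.sqrt C = C ^ (1 - t + t * b) := by
  have h := rpow_wgm_rpow hC 1 b t
  rwa [rpow_one hC.posSemidef, mul_one] at h

end Commuting

/-! ## § 4. `A #_t B ≤ I ⟹ C^t ≤ A⁻¹` and `A ≤ C^{−t}` (`C = A^{-1/2}BA^{-1/2}`) -/

section LeOne

variable {A B : Matrix n n ℂ}

/-- **(2.6), first half: `A #_t B ≤ I ⟹ (A^{-1/2}BA^{-1/2})^t ≤ A⁻¹`** (congruence by `A^{-1/2}`).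
[cite: AndoHiai1994, proof of Thm 2.1 p. 119 («If `A #_α B ≤ I` then `C^α ≤ A⁻¹`»)] -/
theorem rpow_le_inv_of_wgm_le_one (hA : A.PosDef) (t : ℝ)
    (h : (1 - CFC.sqrt A * ((CFC.sqrt A)⁻¹ * B * (CFC.sqrt A)⁻¹) ^ t * CFC.sqrt A).PosSemidef) :
    (A⁻¹ - ((CFC.sqrt A)⁻¹ * B * (CFC.sqrt A)⁻¹) ^ t).PosSemidef := by
  have hSu : IsUnit (CFC.sqrt A).det := isUnit_det_sqrt hA
  have hSih : ((CFC.sqrt A)⁻¹)ᴴ = (CFC.sqrt A)⁻¹ := by rw [conjTranspose_nonsing_inv, conjTranspose_sqrt]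
  have hSS : CFC.sqrt A * CFC.sqrt A = A := CFC.sqrt_mul_sqrt_self A hA.posSemidef.nonneg
  set S := CFC.sqrt A with hSdef
  have h1 := h.conjTranspose_mul_mul_same S⁻¹
  rw [hSih, Matrix.mul_sub, Matrix.sub_mul, Matrix.mul_one] at h1
  have e1 : S⁻¹ * S⁻¹ = A⁻¹ := by rw [← Matrix.mul_inv_rev, hSS]
  have e2 : S⁻¹ * (S * (S⁻¹ * B * S⁻¹) ^ t * S) * S⁻¹ = (S⁻¹ * B * S⁻¹) ^ t := by
    calc S⁻¹ * (S * (S⁻¹ * B * S⁻¹) ^ t * S) * S⁻¹ = S⁻¹ * S * (S⁻¹ * B * S⁻¹) ^ t * (S * S⁻¹) := by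
          simp only [Matrix.mul_assoc]
      _ = (S⁻¹ * B * S⁻¹) ^ t := by rw [nonsing_inv_mul _ hSu, mul_nonsing_inv _ hSu, Matrix.one_mul, Matrix.mul_one]
  rwa [e1, e2] at h1

/-- **(2.6): `A #_t B ≤ I ⟹ A ≤ (A^{-1/2}BA^{-1/2})^{−t}`** (`A, B ≻ 0`; inversion reverses the Loewner order).
[cite: AndoHiai1994, proof of Thm 2.1 p. 119 («so that `A ≤ C^{−α}` (2.6)»)] -/
theorem le_rpow_neg_of_wgm_le_one (hA : A.PosDef) (hB : B.PosDef) (t : ℝ)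
    (h : (1 - CFC.sqrt A * ((CFC.sqrt A)⁻¹ * B * (CFC.sqrt A)⁻¹) ^ t * CFC.sqrt A).PosSemidef) :
    (((CFC.sqrt A)⁻¹ * B * (CFC.sqrt A)⁻¹) ^ (-t) - A).PosSemidef := by
  have hC := posDef_sqrt_inv_mul_mul_sqrt_inv hA hB
  have hAu : IsUnit A.det := isUnit_iff_ne_zero.mpr hA.det_pos.ne'
  have h1 := Literature.LinearAlgebra.Matrix.inv_sub_inv_posSemidef_of_posDef (posDef_rpow hC t)
    (rpow_le_inv_of_wgm_le_one hA t h)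
  rwa [inv_rpow hC, nonsing_inv_nonsing_inv _ hAu] at h1

end LeOne

/-! ## § 5. The step `1 ≤ r ≤ 2` -/

section Step

variable {A B : Matrix n n ℂ}

/-- **Ando–Hiai, the case `1 ≤ r ≤ 2`: `A #_t B ≤ I ⟹ Aʳ #_t Bʳ ≤ I`** (`A, B ≻ 0`, `t ∈ [0, 1]`), by the displayed
computation of the source with `r = 2 − ε`, `C = A^{-1/2}BA^{-1/2}`:
`Aʳ #_t Bʳ = A^{1/2}{A^{1−ε} #_t [C(A #_ε C⁻¹)C]}A^{1/2} ≤ A^{1/2}{C^{−t(1−ε)} #_t [C·C^{−t(1−ε)−ε}·C]}A^{1/2} =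
A^{1/2}C^tA^{1/2} = A #_t B ≤ I`. [cite: AndoHiai1994, Thm 2.1, proof pp. 119–120] -/
theorem andoHiai_step (hA : A.PosDef) (hB : B.PosDef) {t : ℝ} (ht0 : 0 ≤ t) (ht1 : t ≤ 1) {r : ℝ} (hr1 : 1 ≤ r)
    (hr2 : r ≤ 2) (h : (1 - CFC.sqrt A * ((CFC.sqrt A)⁻¹ * B * (CFC.sqrt A)⁻¹) ^ t * CFC.sqrt A).PosSemidef) :
    (1 - CFC.sqrt (A ^ r) * ((CFC.sqrt (A ^ r))⁻¹ * B ^ r * (CFC.sqrt (A ^ r))⁻¹) ^ t * CFC.sqrt (A ^ r)).PosSemidef := by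
  -- bookkeeping: `ε = 2 - r`, `S = A^{1/2}`, `C = S⁻¹ B S⁻¹`
  set ε := 2 - r with hε
  have hε0 : 0 ≤ ε := by linarith
  have hε1 : ε ≤ 1 := by linarith
  have h1ε0 : 0 ≤ 1 - ε := by linarith
  have h1ε1 : 1 - ε ≤ 1 := by linarith
  have hSpd := sqrt_posDef hA
  have hSu : IsUnit (CFC.sqrt A).det := isUnit_det_sqrt hA
  have hSh : (CFC.sqrt A)ᴴ = CFC.sqrt A := conjTranspose_sqrt A
  have hC := posDef_sqrt_inv_mul_mul_sqrt_inv hA hB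
  -- (2.6) and (2.7)
  have h26 := le_rpow_neg_of_wgm_le_one hA hB t h
  have h27 : ((((CFC.sqrt A)⁻¹ * B * (CFC.sqrt A)⁻¹) ^ (-t * (1 - ε))) - A ^ (1 - ε)).PosSemidef := by
    have h1 := posSemidef_rpow_sub_rpow h26 h1ε0 h1ε1
    rwa [rpow_rpow' hC] at h1
  set S := CFC.sqrt A with hSdef
  set C := S⁻¹ * B * S⁻¹ with hCdef
  have hCh : Cᴴ = C := hC.1.eq
  have hSCS : S * C * S = B := by
    calc S * (S⁻¹ * B * S⁻¹) * S = S * S⁻¹ * B * (S⁻¹ * S) := by simp only [Matrix.mul_assoc]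
      _ = B := by rw [mul_nonsing_inv _ hSu, nonsing_inv_mul _ hSu, Matrix.one_mul, Matrix.mul_one]
  have hBinv : B⁻¹ = S⁻¹ * C⁻¹ * S⁻¹ := by
    rw [← hSCS, Matrix.mul_inv_rev, Matrix.mul_inv_rev, Matrix.mul_assoc]
  -- the positive definite actors
  have hCt : (C ^ (-t)).PosDef := posDef_rpow hC _
  have hCe : (C ^ (-t * (1 - ε))).PosDef := posDef_rpow hC _
  have hP : (A ^ (1 - ε)).PosDef := posDef_rpow hA _
  have hG : (S * ((S)⁻¹ * C⁻¹ * (S)⁻¹) ^ ε * S).PosDef := posDef_wgm hA hC.inv ε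
  have hQpsd : (C * (S * (S⁻¹ * C⁻¹ * S⁻¹) ^ ε * S) * C).PosSemidef := by
    have h1 := hG.posSemidef.mul_mul_conjTranspose_same C
    rwa [hCh] at h1
  -- `A #_ε C⁻¹ ≤ C^{-t} #_ε C⁻¹ = C^{(1-ε)(-t) + ε(-1)}`, then congruence by `C`
  have hM := wgm_mono_left hA hCt hC.inv h26 hε0 hε1
  have hMval : CFC.sqrt (C ^ (-t)) * ((CFC.sqrt (C ^ (-t)))⁻¹ * C⁻¹ * (CFC.sqrt (C ^ (-t)))⁻¹) ^ ε *
      CFC.sqrt (C ^ (-t)) = C ^ ((1 - ε) * (-t) + ε * (-1)) := by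
    rw [← rpow_neg_one hC, rpow_wgm_rpow hC]
  have hQ_le : (C ^ ((1 - ε) * (-t) + ε * (-1) + 2) - C * (S * (S⁻¹ * C⁻¹ * S⁻¹) ^ ε * S) * C).PosSemidef := by
    have h1 := hM.mul_mul_conjTranspose_same C
    rw [hCh, Matrix.mul_sub, Matrix.sub_mul, hMval, mul_rpow_mul_self hC] at h1
    exact h1
  have hCtop : (C ^ ((1 - ε) * (-t) + ε * (-1) + 2)).PosDef := posDef_rpow hC _
  -- joint monotonicity and the «direct computation»
  have hmono := wgm_mono hP hCe hCtop h27 hQ_le ht0 ht1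
  have hval : CFC.sqrt (C ^ (-t * (1 - ε))) *
      ((CFC.sqrt (C ^ (-t * (1 - ε))))⁻¹ * C ^ ((1 - ε) * (-t) + ε * (-1) + 2) * (CFC.sqrt (C ^ (-t * (1 - ε))))⁻¹) ^ t *
        CFC.sqrt (C ^ (-t * (1 - ε))) = C ^ t := by
    rw [rpow_wgm_rpow hC]
    congr 1
    ring
  rw [hval] at hmono
  -- congruence by `S = A^{1/2}` and the transformer equality
  have hconj := hmono.mul_mul_conjTranspose_same S
  rw [hSh, Matrix.mul_sub, Matrix.sub_mul] at hconj
  have hSPS : S * A ^ (1 - ε) * S = A ^ r := by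
    rw [hSdef, sqrt_eq_rpow, ← rpow_add_of_posDef hA, ← rpow_add_of_posDef hA]
    congr 1
    rw [hε]
    ring
  have hSQS : S * (C * (S * (S⁻¹ * C⁻¹ * S⁻¹) ^ ε * S) * C) * S = B ^ r := by
    calc S * (C * (S * (S⁻¹ * C⁻¹ * S⁻¹) ^ ε * S) * C) * S
        = S * C * S * (S⁻¹ * C⁻¹ * S⁻¹) ^ ε * (S * C * S) := by simp only [Matrix.mul_assoc]
      _ = B * B⁻¹ ^ ε * B := by rw [hSCS, ← hBinv]
      _ = B ^ r := by
        rw [inv_rpow_eq_rpow_neg hB, mul_rpow_mul_self hB]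
        congr 1
        rw [hε]
        ring
  have htrans : S * (CFC.sqrt (A ^ (1 - ε)) * ((CFC.sqrt (A ^ (1 - ε)))⁻¹ * (C * (S * (S⁻¹ * C⁻¹ * S⁻¹) ^ ε * S) * C) *
      (CFC.sqrt (A ^ (1 - ε)))⁻¹) ^ t * CFC.sqrt (A ^ (1 - ε))) * S =
      CFC.sqrt (A ^ r) * ((CFC.sqrt (A ^ r))⁻¹ * B ^ r * (CFC.sqrt (A ^ r))⁻¹) ^ t * CFC.sqrt (A ^ r) := by
    rw [← sqrt_conj_wgm hP hQpsd hSpd t, hSPS, hSQS]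
  rw [← htrans]
  exact loewner_trans hconj h

end Step

/-! ## § 6. The Ando–Hiai inequality for every `r ≥ 1` -/

section Main

variable {A B : Matrix n n ℂ}

/-- **The Ando–Hiai inequality: `A #_t B ≤ I ⟹ Aʳ #_t Bʳ ≤ I` for every `r ≥ 1`** (`A, B ≻ 0`, `t ∈ [0, 1]`;
«When `r > 2`, writing `r = 2^k s` with `1 ≤ s ≤ 2`, proceed by induction» — here: induction over `k` with
`r < 2^k`, applying the step to `(A^{r/2}, B^{r/2})` with exponent `2`). [cite: AndoHiai1994, Thm 2.1 ((2.5):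
«`A #_α B ≤ I` implies `Aʳ #_α Bʳ ≤ I`»), pp. 119–120] -/
theorem andoHiai (hA : A.PosDef) (hB : B.PosDef) {t : ℝ} (ht0 : 0 ≤ t) (ht1 : t ≤ 1) {r : ℝ} (hr : 1 ≤ r)
    (h : (1 - CFC.sqrt A * ((CFC.sqrt A)⁻¹ * B * (CFC.sqrt A)⁻¹) ^ t * CFC.sqrt A).PosSemidef) :
    (1 - CFC.sqrt (A ^ r) * ((CFC.sqrt (A ^ r))⁻¹ * B ^ r * (CFC.sqrt (A ^ r))⁻¹) ^ t * CFC.sqrt (A ^ r)).PosSemidef := by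
  obtain ⟨k, hk⟩ := pow_unbounded_of_one_lt r (by norm_num : (1 : ℝ) < 2)
  induction k generalizing A B r with
  | zero =>
    exfalso
    rw [pow_zero] at hk
    linarith
  | succ k ih =>
    rcases le_or_gt r 2 with hr2 | hr2
    · exact andoHiai_step hA hB ht0 ht1 hr hr2 h
    · have hk' : r / 2 < 2 ^ k := by
        rw [pow_succ] at hk
        linarith
      have h2 := ih hA hB (by linarith) h hk'
      have h3 := andoHiai_step (posDef_rpow hA (r / 2)) (posDef_rpow hB (r / 2)) ht0 ht1 (r := 2) (by norm_num)
        le_rfl h2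
      rwa [rpow_rpow' hA, rpow_rpow' hB, show r / 2 * (2 : ℝ) = r by ring] at h3

/-- **The case `t = 1/2`: `A#B ≤ I ⟹ Aʳ#Bʳ ≤ I`** for `r ≥ 1`, with the geometric mean in the tree's `CFC.sqrt`
spelling `A#B = A^{1/2}(A^{-1/2}BA^{-1/2})^{1/2}A^{1/2}`. [cite: AndoHiai1994, Thm 2.1 (`α = 1/2`), pp. 118–120] -/
theorem andoHiai_geometricMean (hA : A.PosDef) (hB : B.PosDef) {r : ℝ} (hr : 1 ≤ r)
    (h : (1 - CFC.sqrt A * CFC.sqrt ((CFC.sqrt A)⁻¹ * B * (CFC.sqrt A)⁻¹) * CFC.sqrt A).PosSemidef) :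
    (1 - CFC.sqrt (A ^ r) * CFC.sqrt ((CFC.sqrt (A ^ r))⁻¹ * B ^ r * (CFC.sqrt (A ^ r))⁻¹) *
      CFC.sqrt (A ^ r)).PosSemidef := by
  rw [← wgm_half] at h ⊢
  exact andoHiai hA hB (by norm_num) (by norm_num) hr h

end Main

/-! ## § 7. Homogeneity and the homogeneous form `A #_t B ≤ cI ⟹ Aʳ #_t Bʳ ≤ cʳI` -/

section Homogeneous

variable {A B : Matrix n n ℂ}

/-- `(cS)⁻¹ = c⁻¹S⁻¹` for a nonzero real `c` and nonsingular `S`. [folklore] -/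
private theorem inv_real_smul {S : Matrix n n ℂ} {c : ℝ} (hc : c ≠ 0) (hS : IsUnit S.det) :
    (c • S)⁻¹ = c⁻¹ • S⁻¹ := by
  refine inv_eq_right_inv ?_
  rw [Matrix.smul_mul, Matrix.mul_smul, smul_smul, mul_nonsing_inv _ hS, mul_inv_cancel₀ hc, one_smul]

/-- **Homogeneity `(cA) #_t (cB) = c(A #_t B)`** for a real `c > 0` («both sides of (2.5) have the same order of
homogeneity for `A, B`»). [cite: AndoHiai1994, proof of Thm 2.1 p. 119] -/
theorem wgm_smul (hA : A.PosDef) (B : Matrix n n ℂ) {c : ℝ} (hc : 0 < c) (t : ℝ) :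
    CFC.sqrt (c • A) * ((CFC.sqrt (c • A))⁻¹ * (c • B) * (CFC.sqrt (c • A))⁻¹) ^ t * CFC.sqrt (c • A) =
      c • (CFC.sqrt A * ((CFC.sqrt A)⁻¹ * B * (CFC.sqrt A)⁻¹) ^ t * CFC.sqrt A) := by
  have hSu : IsUnit (CFC.sqrt A).det := isUnit_det_sqrt hA
  set a : ℝ := c ^ (1 / 2 : ℝ) with ha_def
  have ha : 0 < a := Real.rpow_pos_of_pos hc _
  have ha0 : a ≠ 0 := ha.ne'
  have haa : a * a = c := by rw [ha_def, ← Real.rpow_add hc, add_halves, Real.rpow_one]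
  have hsq : CFC.sqrt (c • A) = a • CFC.sqrt A := by
    rw [sqrt_eq_rpow, smul_rpow hA.posSemidef hc, ← sqrt_eq_rpow]
  have hinner : (a⁻¹ • (CFC.sqrt A)⁻¹) * (c • B) * (a⁻¹ • (CFC.sqrt A)⁻¹) = (CFC.sqrt A)⁻¹ * B * (CFC.sqrt A)⁻¹ := by
    rw [← haa]
    simp only [Matrix.smul_mul, Matrix.mul_smul, smul_smul]
    conv_rhs => rw [← one_smul ℝ ((CFC.sqrt A)⁻¹ * B * (CFC.sqrt A)⁻¹)]
    congr 1
    field_simp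
  rw [hsq, inv_real_smul ha0 hSu, hinner, Matrix.smul_mul, Matrix.mul_smul, Matrix.smul_mul, smul_smul, haa]

/-- **Ando–Hiai, homogeneous form: `A #_t B ≤ cI ⟹ Aʳ #_t Bʳ ≤ cʳI`** for `c > 0`, `r ≥ 1` (`A, B ≻ 0`,
`t ∈ [0, 1]`) — the Loewner form of (2.5) `λ₁(Aʳ #_α Bʳ) ≤ λ₁(A #_α B)ʳ`. [cite: AndoHiai1994, Thm 2.1 (2.5),
p. 119] -/
theorem andoHiai_smul (hA : A.PosDef) (hB : B.PosDef) {t : ℝ} (ht0 : 0 ≤ t) (ht1 : t ≤ 1) {r : ℝ} (hr : 1 ≤ r)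
    {c : ℝ} (hc : 0 < c)
    (h : (c • (1 : Matrix n n ℂ) - CFC.sqrt A * ((CFC.sqrt A)⁻¹ * B * (CFC.sqrt A)⁻¹) ^ t * CFC.sqrt A).PosSemidef) :
    (c ^ r • (1 : Matrix n n ℂ) -
      CFC.sqrt (A ^ r) * ((CFC.sqrt (A ^ r))⁻¹ * B ^ r * (CFC.sqrt (A ^ r))⁻¹) ^ t * CFC.sqrt (A ^ r)).PosSemidef := by
  have hci : 0 < c⁻¹ := inv_pos.mpr hc
  -- normalize: `(c⁻¹A) #_t (c⁻¹B) = c⁻¹(A #_t B) ≤ I`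
  have h1 : (1 - CFC.sqrt (c⁻¹ • A) * ((CFC.sqrt (c⁻¹ • A))⁻¹ * (c⁻¹ • B) * (CFC.sqrt (c⁻¹ • A))⁻¹) ^ t *
      CFC.sqrt (c⁻¹ • A)).PosSemidef := by
    rw [wgm_smul hA B hci t]
    have h2 := h.smul hci.le
    rwa [smul_sub, smul_smul, inv_mul_cancel₀ hc.ne', one_smul] at h2
  have h3 := andoHiai (hA.smul hci) (hB.smul hci) ht0 ht1 hr h1
  rw [smul_rpow hA.posSemidef hci, smul_rpow hB.posSemidef hci,
    wgm_smul (posDef_rpow hA r) (B ^ r) (Real.rpow_pos_of_pos hci r) t] at h3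
  -- rescale by `c ^ r`
  have hcr : 0 < c ^ r := Real.rpow_pos_of_pos hc r
  have h4 := h3.smul hcr.le
  rwa [smul_sub, smul_smul, Real.inv_rpow hc.le, mul_inv_cancel₀ hcr.ne', one_smul] at h4

end Homogeneous

end Literature.LinearAlgebra.Matrix.AndoHiaiInequality
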